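import Summits.BirchSwinnertonDyer.BirchSwinnertonDyer.Theorems.PrintCf2SplitBadTwoKummerUClassLevelTwisted
import Summits.BirchSwinnertonDyer.BirchSwinnertonDyer.Theorems.PrintCf2SplitBadTwoKummerUNonSplitValuation
import HarnessLib

/-!
# Crux `PrintCf2.SplitBadTwoRankOneOfFacts` (stmt-BirchSwinnertonDyer-20368), skeleton v13.4, registered stub `stub_xRegular_two` = (REG₂), FACT-FREE
# road, R2 arithmetic input for the SIGN-TWISTED coefficients WITH RAMIFICATION: the class-level (PRO-NULL)_U of -w3 g13 (p704411
# `KummerU.exists_level_resH1Hom_eq_zero_of_local_twisted`) with the unramified hypothesis asked ONLY where `μ(θ₀)` is unramified, and the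
# `v̄` divisibility asked ONLY at the places of `F′` split over `F`

Cell `bsd-print-cf2`, EXTRA WIDTH seat `bsd-line-cf2-p1-w4` g14 (prover-bsd-line-cf2-p1-w4-g14-0); `--supports stmt-BirchSwinnertonDyer-20368`
(helper, Theses-free). HONEST FRAMING: nothing here closes the crux or a registered stub; BSD is not proved by any of this; no summit
statement is proved by this seat. No definition, no named fact, no `sorry`. UNCONDITIONAL (R1 = Baker–Brumer Leopoldt is a tree theorem).

WHY. In the (LSₙ,₂) level lift the dual level module for the sign-corrected quadratic character `θ₀` is `μ_{2^M}(θ₀)`, RAMIFIED at the places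
`S_{θ₀}` of `θ₀`; B2d (-w8 g5, dual Shapiro unfolding of B2c's `hkill`) reads the dual Selmer condition «annihilator of the unramified
classes» as «`conj_σ y′ ∈ unramifiedKer`» through `UnramifiedOrthogonal`, which the tree states ONLY under `GaloisRep.IsUnramifiedAt`
(`PoitouTateSelmerStructures.UnramifiedOrthogonal`). So at `S_{θ₀}` NOTHING is delivered, and p704411 — which asks
`conj_σ [φ] ∈ unramifiedKer U X w` at EVERY `w ∉ {v, v̄}` — cannot be fed there. THIS FILE removes the gap: by the NON-SPLIT VALUATION TRICK
(p704813 `KummerUDict.dvd_two_mul_log_valuation_of_twisted_of_mem_inertia`) the R1 valuation hypothesis at the places of `F′ = F·K_{θ₀}`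
above a `θ₀`-RAMIFIED `w` (where `I_𝔓 ≤ U = Gal(K̄/F)` and some `s ∈ I_𝔓` has `ε s = −1`) follows from the twisted cocycle ALONE, at the cost
of ONE level (`2^{M} ∣ 2·ord ⟹ 2^{M−1} ∣ ord`); likewise at the places above `v̄` stabilised by such an `s` (NOT split in `F′/F`).

WHAT. **`exists_level_resH1Hom_eq_zero_of_local_twisted_ramified`** — the statement of p704411 VERBATIM except:
* the unramified hypothesis becomes, for each `w ∉ {v, v̄}`:
  `(∀ σ, conjH1 U X σ [φ] ∈ unramifiedKer U X w) ∨ (GreenbergSelmer.inertia w ≤ U ∧ ∃ τ ∈ GreenbergSelmer.inertia w, ε τ ≠ 1)`;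
* the `v̄` hypothesis becomes, for each `w′ ∣ v̄` of `F′`:
  `p^M ∣ ord_{w′} b′ ∨ (∃ 𝔓 over w′, ∃ s ∈ U, ε s ≠ 1 ∧ s • 𝔓 = 𝔓)`.
PROOF = -w3's assembly one level down: class level `M = M₀ + 1` where `M₀ = M_{F′}(k + e)` is R1's level (p696581
`KummerProNull.exists_level_forall_exists_pow_eq_of_local`, valuation form); at `w′ ∤ v` of `F′`: unramified branch → root form
(p703858 `exists_root_fixed_of_resOfLe_conjH1_eq_zero`, p702625 `forall_primesAbove_exists_root_fixed_of_forall_conj`) → B4b p701755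
(`dvd_log_valuation_of_galFixing_inter_inertia_fixes_root`): `p^M ∣ ord`; ramified / non-split branch → p704813: `p^M ∣ 2·ord`; both give
`p^{M₀} ∣ ord` (`prime_pow_dvd_of_pow_succ_dvd_two_mul`); at `w′ ∣ v`: B4c p701271 (`exists_pow_eq_adicCompletion_of_forall_exists_root_fixed`)
from `awayKer`; then R1 ⟹ `b′ = y₀^{p^{k+e}}`, θ-descent p703424 (`twisted_proNull_of_untwisted`, `k + e ≤ M₀ ≤ M`), kill read-back p703858.
Helpers: `prime_pow_dvd_of_pow_succ_dvd_two_mul` (`p^{M+1} ∣ 2a ⟹ p^M ∣ a`, any prime), `units_val_eq_neg_one_of_ne_one` (`ℤˣ`),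
`exists_mem_inertia_sign_eq_neg_one` (transport of the ramified element to ANY prime above `w` inside the normal `U`).
presearch: as p704411/p704813 (NSW (1.6.x), Serre X §3 b), de Shalit III.2.3); no new fact. beyond-print theorem: no.

References: [deShalit1987] III.2.3; [SerreLocalFields1979] X §3 b); [NeukirchSchmidtWingberg2008] (1.6.6)–(1.6.7); [NeukirchANT1999] Ch. I §9.
-/

noncomputable section

set_option linter.dupNamespace false
set_option autoImplicit false

open scoped Classical Pointwise
open NumberField IsDedekindDomain Field IntermediateField
open Literature.NumberTheory.EllipticCurves Literature.NumberTheory.EllipticCurves.GreenbergSelmer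
open Literature.NumberTheory.EllipticCurves.GreenbergVatsal2000
open Literature.NumberTheory.GaloisRepresentations Literature.NumberTheory.GaloisRepresentations.LocalWeilDatum
open Summit.BirchSwinnertonDyer.BirchSwinnertonDyer.Theorems.PrintCf2.KummerU
open Summit.BirchSwinnertonDyer.BirchSwinnertonDyer.Theorems.PrintCf2.UpperBaseLift

namespace Summit.BirchSwinnertonDyer.BirchSwinnertonDyer.Theorems.PrintCf2.KummerUDict

/-! ## §1. Small helpers -/

/-- `p^{M+1} ∣ 2·a ⟹ p^M ∣ a` for any prime `p` (for `p = 2` divide by `2`; for odd `p`, `p^{M+1}` is coprime to `2`). [folklore] -/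
theorem prime_pow_dvd_of_pow_succ_dvd_two_mul {p : ℕ} (hp : p.Prime) {M : ℕ} {a : ℤ} (h : ((p ^ (M + 1) : ℕ) : ℤ) ∣ 2 * a) :
    ((p ^ M : ℕ) : ℤ) ∣ a := by
  by_cases hp2 : p = 2
  · subst hp2
    exact pow_dvd_of_pow_succ_dvd_two_mul h
  · have hcop : IsCoprime ((p ^ (M + 1) : ℕ) : ℤ) (2 : ℤ) := by
      rw [Int.isCoprime_iff_gcd_eq_one, show (2 : ℤ) = ((2 : ℕ) : ℤ) from rfl, Int.gcd_natCast_natCast]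
      exact (Nat.Coprime.pow_left _ ((Nat.coprime_primes hp Nat.prime_two).mpr hp2))
    have h1 : ((p ^ (M + 1) : ℕ) : ℤ) ∣ a := hcop.dvd_of_dvd_mul_left h
    exact (Int.natCast_dvd_natCast.mpr (pow_dvd_pow p (Nat.le_succ M))).trans h1

/-- A unit of `ℤ` which is not `1` is `−1`. [folklore] -/
theorem units_val_eq_neg_one_of_ne_one {u : ℤˣ} (hu : u ≠ 1) : ((u : ℤˣ) : ℤ) = -1 := by
  rcases Int.units_eq_one_or u with h | h
  · exact absurd h hu
  · rw [h, Units.val_neg, Units.val_one]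

variable {K : Type} [Field K] [NumberField K]

/-- **The ramified sign element at ANY prime above `w`.** If the chosen inertia group `I_w` lies in the normal subgroup `U` and contains
some `τ` with `ε τ ≠ 1`, then every prime `𝔓` of `\bar ℤ_K` above `w` has some `s ∈ U ∩ I_𝔓` with `ε s = −1` (transport along
`𝔓 = g•𝔓₀`, `I_{g𝔓₀} = g I_𝔓₀ g⁻¹`; `ε` takes values in the abelian group `ℤˣ`). [cite: NeukirchANT1999, Ch. I §9 (9.1), (9.4)] -/
theorem exists_mem_inertia_sign_eq_neg_one (U : Subgroup (absoluteGaloisGroup K)) [U.Normal] (ε : absoluteGaloisGroup K →* ℤˣ)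
    {w : HeightOneSpectrum (𝓞 K)} (hIU : GreenbergSelmer.inertia w ≤ U) (hram : ∃ τ ∈ GreenbergSelmer.inertia w, ε τ ≠ 1)
    {𝔓 : Ideal (absIntegers (𝓞 K) K)} (h𝔓 : 𝔓 ∈ w.primesAbove) :
    ∃ s : absoluteGaloisGroup K, s ∈ U ∧ ((ε s : ℤˣ) : ℤ) = -1 ∧ s ∈ 𝔓.inertia (absoluteGaloisGroup K) := by
  obtain ⟨τ, hτI, hετ⟩ := hram
  obtain ⟨g, hg⟩ := HeightOneSpectrum.exists_smul_eq_of_mem_primesAbove_holds (K := K) (v := w)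
    (adicCompletionPrime_mem_primesAbove K w) h𝔓
  have hI : GreenbergSelmer.inertia w = (adicCompletionPrime K w).inertia (absoluteGaloisGroup K) :=
    (inertia_adicCompletionPrime_eq_map_absInertia K w).symm
  refine ⟨g * τ * g⁻¹, Subgroup.Normal.conj_mem inferInstance τ (hIU hτI) g, ?_, ?_⟩
  · have hε : ε (g * τ * g⁻¹) = ε τ := by
      rw [map_mul, map_mul, map_inv, mul_comm (ε g) (ε τ), mul_assoc, mul_inv_cancel, mul_one]
    rw [hε]
    exact units_val_eq_neg_one_of_ne_one hετ
  · rw [← hg, mem_inertia_pointwise_smul_iff, show g⁻¹ * (g * τ * g⁻¹) * g = τ by group, ← hI]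
    exact hτI

/-! ## §2. The class-level twisted (PRO-NULL)_U with ramification -/

variable {p : ℕ} [Fact p.Prime]

/-- **CLASS-LEVEL (PRO-NULL)_U FOR TWISTED COEFFICIENTS `μ(θ₀)`, RAMIFICATION ALLOWED.** See the module docstring: p704411 with the
unramified hypothesis at `w ∉ {v, v̄}` replaced by «unramifiedKer OR (`I_w ≤ U` and `ε` ramified at `w`)», and the `v̄` divisibility replaced
by «divisible OR stabilised by a sign `−1` element of `U`». `F ⊆ F′ ⊆ K̄`, `U = Gal(K̄/F)`, `Gal(K̄/F′) = {u ∈ U : ε u = 1}`, `F′/K` finite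
abelian, `K` imaginary quadratic, `p = v v̄`. [cite: deShalit1987, III.2.3 (Theorem (Baker–Brumer))] [cite: SerreLocalFields1979, X §3 b)]
[cite: NeukirchSchmidtWingberg2008, (1.6.6)–(1.6.7)] -/
theorem exists_level_resH1Hom_eq_zero_of_local_twisted_ramified (hK : IsImaginaryQuadratic K) {v vbar : HeightOneSpectrum (𝓞 K)}
    (hv : ((p : ℕ) : 𝓞 K) ∈ v.asIdeal) (hvbar : ((p : ℕ) : 𝓞 K) ∈ vbar.asIdeal) (hne : vbar ≠ v)
    (F F' : IntermediateField K (AlgebraicClosure K)) [FiniteDimensional K F'] [IsAbelianGalois K F'] [NumberField F']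
    [(galFixing K F).Normal] [(galFixing K F').Normal] (ε : absoluteGaloisGroup K →* ℤˣ)
    (hU' : galFixing K F' ≤ galFixing K F) (hεU' : ∀ u ∈ galFixing K F', ε u = 1)
    (hker : ∀ u ∈ galFixing K F, ε u = 1 → u ∈ galFixing K F') (k : ℕ) :
    ∃ M : ℕ, k ≤ M ∧
      ∀ {X : Type} [AddCommGroup X] [DistribMulAction (absoluteGaloisGroup K) X] [TopologicalSpace X] [DiscreteTopology X]
        {X₀ : Type} [AddCommGroup X₀] [DistribMulAction (absoluteGaloisGroup K) X₀] [TopologicalSpace X₀] [DiscreteTopology X₀]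
        (ι : X →+ Additive (AlgebraicClosure K)ˣ) (_ : Function.Injective ι)
        (_ : ∀ (g : absoluteGaloisGroup K) (x : X), Additive.toMul (ι (g • x)) = (g • Additive.toMul (ι x)) ^ ((ε g : ℤˣ) : ℤ))
        (_ : ∀ x : X, p ^ M • x = 0)
        (ι₀ : X₀ →+ Additive (AlgebraicClosure K)ˣ) (_ : Function.Injective ι₀)
        (_ : ∀ (g : absoluteGaloisGroup K) (x : X₀), Additive.toMul (ι₀ (g • x)) = (g • Additive.toMul (ι₀ x)) ^ ((ε g : ℤˣ) : ℤ))
        (_ : ∀ m : (AlgebraicClosure K)ˣ, m ^ p ^ k = 1 → ∃ a₀ : X₀, Additive.toMul (ι₀ a₀) = m)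
        (t : X →+ X₀) (ht : ∀ (g : absoluteGaloisGroup K) (x : X), t (g • x) = g • t x)
        (_ : ∀ x : X, Additive.toMul (ι₀ (t x)) = Additive.toMul (ι x) ^ p ^ (M - k))
        (φ : contOneCocycles (discreteTopRep (galFixing K F) X)),
        (∀ σ : absoluteGaloisGroup K, conjH1 (galFixing K F) X σ (oneCocycleClass _ φ) ∈ awayKer (galFixing K F) X v) →
        (∀ w : HeightOneSpectrum (𝓞 K), w ≠ v → w ≠ vbar →
          (∀ σ : absoluteGaloisGroup K, conjH1 (galFixing K F) X σ (oneCocycleClass _ φ) ∈ unramifiedKer (galFixing K F) X w) ∨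
          (GreenbergSelmer.inertia w ≤ galFixing K F ∧ ∃ τ ∈ GreenbergSelmer.inertia w, ε τ ≠ 1)) →
        (∀ β : (AlgebraicClosure K)ˣ,
          (∀ u : galFixing K F', Additive.toMul (ι (φ.1 ⟨u, hU' u.2⟩)) = (u : absoluteGaloisGroup K) • β / β) →
          ∀ b : F', ((b : F') : AlgebraicClosure K) = ((β ^ p ^ M : (AlgebraicClosure K)ˣ) : AlgebraicClosure K) →
          ∀ w' : vbar.Extension (𝓞 F'),
            ((p ^ M : ℕ) : ℤ) ∣ WithZero.log (w'.1.valuation F' b) ∨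
            ∃ 𝔓 : Ideal (absIntegers (𝓞 K) K),
              𝔓.comap (ringOfIntegersToIntegralClosure (k := K) (Ω := AlgebraicClosure K) F') = w'.1.asIdeal ∧
              ∃ s ∈ galFixing K F, ε s ≠ 1 ∧ s • 𝔓 = 𝔓) →
        resH1Hom (ContinuousMonoidHom.id (galFixing K F)) t (fun g x ↦ ht g x) (oneCocycleClass _ φ) = 0 := by
  have hp : p.Prime := Fact.out
  -- the shift `e` for `F′`, R1's level `M₀ = M_{F′}(k + e)` and the class level `M = M₀ + 1`
  obtain ⟨e, he⟩ := exists_pow_prime_pow_eq_one_of_forall_galFixing_smul_eq (K := K) F' hp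
  obtain ⟨M₀, hkeM₀, hM₀⟩ := KummerProNull.exists_level_forall_exists_pow_eq_of_local (p := p) hK hv hvbar hne F' (k + e)
  refine ⟨M₀ + 1, le_trans (Nat.le_add_right k e) (hkeM₀.trans (Nat.le_succ M₀)), ?_⟩
  intro X _ _ _ _ X₀ _ _ _ _ ι hιinj hι hX ι₀ hι₀inj hι₀ hι₀surj t ht htι φ hloc hunr hbar
  set M := M₀ + 1 with hMdef
  -- §1: the attached twisted cocycle `c : Γ_K → K̄ˣ` on `U`
  obtain ⟨c, hc, hcc, hcM⟩ := exists_twistedCocycle_of_oneCocycle (galFixing K F) ε ι hι φ hX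
  -- Kummer over `U′ = Gal(K̄/F′)` (untwisted there): `c = ∂β` on `U′`, `β^{p^M} = b′ ∈ F′`
  have hcoc : ∀ g h : galFixing K F', (fun g : galFixing K F' ↦ c g) (g * h) =
      (fun g : galFixing K F' ↦ c g) g * (g : absoluteGaloisGroup K) • (fun g : galFixing K F' ↦ c g) h := by
    intro g h
    simp only [Subgroup.coe_mul]
    rw [hcc g (hU' g.2) h (hU' h.2), hεU' g g.2, Units.val_one, zpow_one]
  have hopen : IsOpen {g : galFixing K F' | (fun g : galFixing K F' ↦ c g) g = 1} := by
    have h0 : {g : galFixing K F' | (fun g : galFixing K F' ↦ c g) g = 1} =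
        (fun g : galFixing K F' ↦ φ.1 ⟨g, hU' g.2⟩) ⁻¹' {0} := by
      ext g
      simp only [Set.mem_setOf_eq, Set.mem_preimage, Set.mem_singleton_iff, hc g (hU' g.2)]
      constructor
      · intro h
        apply hιinj
        rw [map_zero]
        exact Additive.toMul.injective (by rw [h, toMul_zero])
      · intro h
        rw [h, map_zero, toMul_zero]
    rw [h0]
    exact (isOpen_discrete _).preimage (φ.1.continuous.comp (continuous_inclusion hU'))
  have hn : ∀ g : galFixing K F', (fun g : galFixing K F' ↦ c g) g ^ p ^ M = 1 := fun g ↦ hcM g (hU' g.2)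
  obtain ⟨β, b, hb, hcβ⟩ := galFixing.exists_kummer_of_cocycle_charZero F' (p ^ M) _ hcoc hopen hn
  have hres : ∀ u ∈ galFixing K F', c u = u • β / β := fun u hu ↦ hcβ ⟨u, hu⟩
  have hres' : ∀ u ∈ galFixing K F', ((c u : (AlgebraicClosure K)ˣ) : AlgebraicClosure K) =
      u • (β : AlgebraicClosure K) / β := fun u hu ↦ by
    rw [hres u hu, Units.val_div_eq_div_val, Units.coe_smul]
  have hβM : ((β : AlgebraicClosure K)) ^ p ^ M = ((b : F') : AlgebraicClosure K) := hb.symm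
  have hb0 : b ≠ 0 := by
    intro h0
    rw [h0] at hb
    exact (β ^ p ^ M).ne_zero (by rw [Units.val_pow_eq_pow_val]; exact hb.symm.trans (map_zero _))
  have hpow : p ^ M = p ^ M₀ * p := by rw [hMdef, pow_succ]
  -- §2 (v): local `p^{M₀}`-th powers above `v` from `awayKer` (root form at level `M`, B4c, then one level down)
  have hrootv : ∀ σ : absoluteGaloisGroup K, ∃ β' : AlgebraicClosure K, β' ^ p ^ M = ((b : F') : AlgebraicClosure K) ∧
      ∀ τ : absoluteGaloisGroup K, τ ∈ galFixing K F' → σ * τ * σ⁻¹ ∈ decomp v → τ • β' = β' := by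
    intro σ
    obtain ⟨β', hβ', hfix⟩ := exists_root_fixed_of_resOfLe_conjH1_eq_zero hι φ hX hc hU' hεU' hres (decomp v) σ (hloc σ)
    refine ⟨(β' : AlgebraicClosure K), ?_, fun τ hτ hτD ↦ ?_⟩
    · rw [← hβM, ← Units.val_pow_eq_pow_val, hβ', Units.val_pow_eq_pow_val]
    · rw [← Units.coe_smul, hfix τ hτ hτD]
  have hlocal : ∀ w : v.Extension (𝓞 F'), ∃ y : w.1.adicCompletion F', y ^ p ^ M₀ = algebraMap F' (w.1.adicCompletion F') b := by
    intro w
    obtain ⟨y, hy⟩ := exists_pow_eq_adicCompletion_of_forall_exists_root_fixed F' v (p ^ M) b hrootv w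
    exact ⟨y ^ p, by rw [← pow_mul, mul_comm, ← hpow, hy]⟩
  -- §2 (away from `v`): `p^{M₀} ∣ ord_{w′}(b′)` at every place `w′ ∤ v` of `F′`
  have hval : ∀ w' : HeightOneSpectrum (𝓞 F'), w'.under (𝓞 K) ≠ v →
      ((p ^ M₀ : ℕ) : ℤ) ∣ WithZero.log (w'.valuation F' b) := by
    intro w' hw'v
    -- from `p^M ∣ 2 · ord` or `p^M ∣ ord`
    have hweak : ((p ^ M : ℕ) : ℤ) ∣ WithZero.log (w'.valuation F' b) → ((p ^ M₀ : ℕ) : ℤ) ∣ WithZero.log (w'.valuation F' b) :=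
      fun h ↦ (Int.natCast_dvd_natCast.mpr (pow_dvd_pow p (Nat.le_succ M₀))).trans h
    have htwo : ((p ^ M : ℕ) : ℤ) ∣ 2 * WithZero.log (w'.valuation F' b) → ((p ^ M₀ : ℕ) : ℤ) ∣ WithZero.log (w'.valuation F' b) :=
      fun h ↦ prime_pow_dvd_of_pow_succ_dvd_two_mul hp h
    -- a prime `𝔓` of `\bar ℤ_K` above `w′`, above the place `w := w′ ∩ K`
    obtain ⟨𝔓, h𝔓, h𝔓w⟩ := exists_prime_absIntegers_comap_eq F' w'
    haveI := h𝔓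
    have hunder := comap_algebraMap_eq_under_of_comap_eq F' h𝔓w
    have hmem : 𝔓 ∈ (w'.under (𝓞 K)).primesAbove := HeightOneSpectrum.mem_primesAbove_iff.2 ⟨h𝔓, ⟨hunder.symm⟩⟩
    by_cases hwbar : w'.under (𝓞 K) = vbar
    · -- above `v̄`: divisibility given, or the non-split trick
      rcases hbar β (fun u ↦ by rw [← hc u (hU' u.2)]; exact hcβ u) b (by rw [Units.val_pow_eq_pow_val]; exact hb) ⟨w', hwbar⟩ with
        hdiv | ⟨𝔓', h𝔓'w, s, hsU, hεs, hs𝔓'⟩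
      · exact hweak hdiv
      · exact htwo (dvd_two_mul_log_valuation_of_twisted (galFixing K F) ε F' hU' hεU' hker hcc β.ne_zero hres' hb w' 𝔓' h𝔓'w
          hsU (units_val_eq_neg_one_of_ne_one hεs) (hcM s hsU) hs𝔓')
    · rcases hunr (w'.under (𝓞 K)) hw'v hwbar with hunrw | ⟨hIU, hram⟩
      · -- unramified branch: root form, prime form, B4b
        have hrootw : ∀ σ : absoluteGaloisGroup K, ∃ β' : AlgebraicClosure K, β' ^ p ^ M = ((b : F') : AlgebraicClosure K) ∧
            ∀ τ : absoluteGaloisGroup K, τ ∈ galFixing K F' →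
              σ * τ * σ⁻¹ ∈ GreenbergSelmer.inertia (w'.under (𝓞 K)) → τ • β' = β' := by
          intro σ
          have h0 := (mem_unramifiedKer_iff_resOfLe_inf_inertia_eq_zero (H := galFixing K F) (w := w'.under (𝓞 K)) _).1 (hunrw σ)
          obtain ⟨β', hβ', hfix⟩ := exists_root_fixed_of_resOfLe_conjH1_eq_zero hι φ hX hc hU' hεU' hres
            (GreenbergSelmer.inertia (w'.under (𝓞 K))) σ h0
          refine ⟨(β' : AlgebraicClosure K), ?_, fun τ hτ hτI ↦ ?_⟩
          · rw [← hβM, ← Units.val_pow_eq_pow_val, hβ', Units.val_pow_eq_pow_val]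
          · rw [← Units.coe_smul, hfix τ hτ hτI]
        obtain ⟨β', hβ', hτ⟩ := forall_primesAbove_exists_root_fixed_of_forall_conj (galFixing K F') (w'.under (𝓞 K)) hrootw 𝔓 hmem
        exact hweak (by
          exact_mod_cast dvd_log_valuation_of_galFixing_inter_inertia_fixes_root F' (pow_pos hp.pos M) hβ' w' 𝔓 h𝔓w hτ)
      · -- ramified branch: the non-split valuation trick
        obtain ⟨s, hsU, hεs, hsI⟩ := exists_mem_inertia_sign_eq_neg_one (galFixing K F) ε hIU hram hmem
        exact htwo (dvd_two_mul_log_valuation_of_twisted_of_mem_inertia (galFixing K F) ε F' hU' hεU' hker hcc β.ne_zero hres' hb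
          w' 𝔓 h𝔓w hsU hεs (hcM s hsU) hsI)
  -- R1 over `F′` at level `k + e`
  obtain ⟨y₀, hy₀⟩ := hM₀ b hb0 hval hlocal
  have hy₀0 : y₀ ≠ 0 := by
    intro h0
    rw [h0, zero_pow (pow_ne_zero _ hp.ne_zero)] at hy₀
    exact hb0 hy₀.symm
  have hβy : (β : AlgebraicClosure K) ^ p ^ M = ((y₀ : F') : AlgebraicClosure K) ^ p ^ (k + e) := by
    rw [hβM, ← hy₀]
    rfl
  -- θ-descent: `c^{p^{M−k}}` is a twisted coboundary of a `p^k`-th root of unity on `U`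
  obtain ⟨m, hmk, hcob⟩ := twisted_proNull_of_untwisted F' he hU' hεU' hker hcc (hkeM₀.trans (Nat.le_succ M₀)) hcM β.ne_zero hres'
    hy₀0 hβy
  -- the pushed class vanishes
  exact resH1Hom_id_eq_zero_of_twistedCoboundary ι₀ hι₀inj hι₀ t ht htι φ hc (hι₀surj m hmk) hcob

end Summit.BirchSwinnertonDyer.BirchSwinnertonDyer.Theorems.PrintCf2.KummerUDict

end
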